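import Literature.NumberTheory.Sieve.ChenTwinSieveUpperSum
import HarnessLib

/-!
# Prime sums against a continuous weight: `∑_{x^a ≤ q < x^b} g(log q/log x)/(q − 1) ≤ ∫_a^b g(t) dt/t + ε`

Topic `Literature/NumberTheory/Sieve`. In the upper bound for `∑_q S(𝒜_q, z)` of Chen's theorem
(Nathanson, *Additive Number Theory: The Classical Bases*, Thm 10.5; Chen Jing-run, Sci. Sinica 16
(1973), Lemma 9, (32)) the linear sieve produces, for each prime `q` in a range `x^a ≤ q < x^b`, a main
term `(X/φ(q)) V(z) F(s_q)` whose coefficient depends on `q` only through `log q/log x`, and the prime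
number theorem in Mertens' form `∑_{u ≤ q < w} 1/(q − 1) = log(log w/log u) + o(1)` turns the prime sum
into the integral `∫_a^b F(s(t)) dt/t` (Nathanson p. 175: "`= ∫_{1/8}^{1/3} dα/(α(1/2 − α)) + o(1)`";
Chen (32): the `α`-integrals of `F(5 − 10α)`). `ChenTwinSieveUpperSum.sum_primesIco_weight_le` proves
this for the particular weight `(1/4)/(1/2 − t)` of Nathanson's parameters by a telescoping device;
this file PROVES the general statement for an arbitrary continuous nonnegative weight, which is what
Chen's parameters (`z = x^{1/10}`, weight `F₁(5 − 10t)` with `F₁` given by different formulas on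
`(0, 3]` and `[3, 5]`) require:

* `eventually_sum_prime_weight_le_integral` — for `0 < a < b`, `κ₀ > 0`, `g` continuous and `≥ 0` on
  `[a, b + κ₀]`, and `ε > 0`, there is `0 < κ ≤ κ₀` such that for all large `x ∈ ℕ` and every finite set
  `Q` of primes in `[x^a, x^{b+κ})`,
  `∑_{q ∈ Q} g(log q/log x)/(q − 1) ≤ ∫_a^b g(t) dt/t + ε`.

Proof: cut `[a, b]` into `K` blocks `[tᵢ, tᵢ₊₁]` of length `< ρ`, `ρ` a modulus of uniform continuity
of `g` for `ω`; on a block `g(log q/log x) ≤ g(tᵢ) + ω` and `∑ 1/(q − 1) ≤ η + log(tᵢ₊₁/tᵢ)`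
(`Chen.exists_sum_inv_sub_one_le`, Mertens), while
`(g(tᵢ) + ω) log(tᵢ₊₁/tᵢ) = ∫_{tᵢ}^{tᵢ₊₁} (g(tᵢ) + ω) dt/t ≤ ∫_{tᵢ}^{tᵢ₊₁} (g(t) + 2ω) dt/t`; the primes of
`[x^b, x^{b+κ})` contribute at most `M(η + log((b + κ)/b))`, `M = sup g`. No Riemann-sum theory is
needed, and no named facts are introduced.

## References

* M. B. Nathanson, *Additive Number Theory: The Classical Bases*, GTM 164 (1996), proof of Thm 10.5,
  pp. 174–175 of the held copy. [Nathanson1996]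
* Chen Jing-run, Sci. Sinica 16 (1973) 157–176, Lemma 9, (32) (reprint PDF p. 167). [ChenSciSinica1973]
-/

open Finset Filter Topology

noncomputable section

namespace Literature.NumberTheory.Sieve.Chen

open ChenSieve

/-- `t ↦ (g(t) + c)/t` is continuous on `[u, v]` if `g` is and `u > 0`. [folklore] -/
theorem continuousOn_add_div {g : ℝ → ℝ} {u v c : ℝ} (hu : 0 < u) (hg : ContinuousOn g (Set.Icc u v)) :
    ContinuousOn (fun t : ℝ => (g t + c) / t) (Set.Icc u v) :=
  (hg.add continuousOn_const).div continuousOn_id fun t ht => by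
    show t ≠ 0
    exact ne_of_gt (lt_of_lt_of_le hu ht.1)

/-- On a block: if `c ≤ g(t) + ω` for `t ∈ [u, v]` (`0 < u ≤ v`) and `g` is continuous there, then
`(c + ω) log(v/u) ≤ ∫_u^v (g(t) + 2ω) dt/t`. [folklore] -/
theorem mul_log_div_le_integral {g : ℝ → ℝ} {u v ω c : ℝ} (hu : 0 < u) (huv : u ≤ v)
    (hg : ContinuousOn g (Set.Icc u v)) (hc : ∀ t ∈ Set.Icc u v, c ≤ g t + ω) :
    (c + ω) * Real.log (v / u) ≤ ∫ t in u..v, (g t + 2 * ω) / t := by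
  have hv : 0 < v := lt_of_lt_of_le hu huv
  have h1 : ∫ t in u..v, (c + ω) / t = (c + ω) * Real.log (v / u) := by
    simp_rw [div_eq_mul_inv (c + ω)]
    rw [intervalIntegral.integral_const_mul, integral_inv_of_pos hu hv]
  rw [← h1]
  have hcont1 : ContinuousOn (fun t : ℝ => (c + ω) / t) (Set.Icc u v) :=
    continuousOn_const.div continuousOn_id fun t ht => by
      show t ≠ 0
      exact ne_of_gt (lt_of_lt_of_le hu ht.1)
  have hcont2 : ContinuousOn (fun t : ℝ => (g t + 2 * ω) / t) (Set.Icc u v) := continuousOn_add_div hu hg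
  refine intervalIntegral.integral_mono_on huv (hcont1.intervalIntegrable_of_Icc huv)
    (hcont2.intervalIntegrable_of_Icc huv) fun t ht => ?_
  have ht0 : 0 < t := lt_of_lt_of_le hu ht.1
  exact div_le_div_of_nonneg_right (by linarith [hc t ht]) ht0.le

set_option maxHeartbeats 400000 in
/-- **Prime sums against a continuous weight.** Let `0 < a < b`, `κ₀ > 0`, and let `g` be continuous
and nonnegative on `[a, b + κ₀]`. For every `ε > 0` there is `0 < κ ≤ κ₀` such that for all large
`x ∈ ℕ` and every finite set `Q` of primes `q` with `x^a ≤ q < x^{b+κ}`,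
`∑_{q ∈ Q} g(log q/log x)/(q − 1) ≤ ∫_a^b g(t) dt/t + ε`
(Nathanson p. 175 / Chen (32): the prime sums of the upper bound for `∑_q S(𝒜_q, z)` as `α`-integrals).
[cite: Nathanson1996, §10.5 (proof of Thm 10.5, pp. 174–175)] -/
theorem eventually_sum_prime_weight_le_integral {a b κ₀ : ℝ} (ha : 0 < a) (hab : a < b)
    (hκ₀ : 0 < κ₀) {g : ℝ → ℝ} (hg : ContinuousOn g (Set.Icc a (b + κ₀)))
    (hg0 : ∀ t ∈ Set.Icc a (b + κ₀), 0 ≤ g t) {ε : ℝ} (hε : 0 < ε) :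
    ∃ κ : ℝ, 0 < κ ∧ κ ≤ κ₀ ∧ ∀ᶠ x : ℕ in atTop, ∀ Q : Finset ℕ,
      (∀ q ∈ Q, q.Prime ∧ (x : ℝ) ^ a ≤ q ∧ (q : ℝ) < (x : ℝ) ^ (b + κ)) →
        ∑ q ∈ Q, g (Real.log q / Real.log x) / ((q : ℝ) - 1) ≤ (∫ t in a..b, g t / t) + ε := by
  have hb : 0 < b := ha.trans hab
  -- a bound `M ≥ 1` for `g`
  obtain ⟨M₀, hM₀⟩ := isCompact_Icc.exists_bound_of_continuousOn hg
  set M := max M₀ 1 with hM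
  have hM1 : 1 ≤ M := le_max_right _ _
  have hM0 : 0 < M := by linarith
  have hgM : ∀ t ∈ Set.Icc a (b + κ₀), g t ≤ M := fun t ht =>
    ((le_abs_self _).trans ((Real.norm_eq_abs _).symm.le.trans (hM₀ t ht))).trans (le_max_left _ _)
  -- the accuracy `ω` of the uniform continuity and its modulus `ρ`
  set Lg := Real.log (b / a) + 1 with hLg
  have hlogba : 0 < Real.log (b / a) := Real.log_pos ((one_lt_div ha).mpr hab)
  have hLg0 : 0 < Lg := by linarith
  set ω := ε / (8 * Lg) with hω
  have hω0 : 0 < ω := by positivity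
  have huc := isCompact_Icc.uniformContinuousOn_of_continuous hg
  obtain ⟨ρ, hρ0, hρ⟩ := Metric.uniformContinuousOn_iff.mp huc ω hω0
  -- the blocks
  set K : ℕ := ⌈(b - a) / ρ⌉₊ + 1 with hKdef
  have hK1 : 1 ≤ K := by omega
  have hKpos : (0 : ℝ) < K := by exact_mod_cast (show 0 < K by omega)
  set hs := (b - a) / K with hhs
  have hhs0 : 0 < hs := by rw [hhs]; exact div_pos (by linarith) hKpos
  have hhsρ : hs < ρ := by
    rw [hhs, div_lt_iff₀ hKpos]
    have h1 : (b - a) / ρ ≤ ⌈(b - a) / ρ⌉₊ := Nat.le_ceil _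
    have h2 : ((⌈(b - a) / ρ⌉₊ : ℕ) : ℝ) + 1 = K := by rw [hKdef]; push_cast; ring
    rw [div_le_iff₀ hρ0] at h1
    nlinarith
  set t : ℕ → ℝ := fun i => a + i * hs with ht
  have ht0 : t 0 = a := by simp [ht]
  have htK : t K = b := by simp only [ht, hhs]; field_simp; ring
  have htmono : ∀ i : ℕ, t i < t (i + 1) := fun i => by simp only [ht]; push_cast; nlinarith
  have htmono' : ∀ i j : ℕ, i ≤ j → t i ≤ t j := fun i j hij => by
    simp only [ht]
    have : (i : ℝ) ≤ j := by exact_mod_cast hij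
    nlinarith
  have htstep : ∀ i : ℕ, t (i + 1) - t i = hs := fun i => by simp only [ht]; push_cast; ring
  have hta : ∀ i : ℕ, a ≤ t i := fun i => by rw [← ht0]; exact htmono' 0 i (Nat.zero_le i)
  have htb : ∀ i : ℕ, i ≤ K → t i ≤ b := fun i hi => by rw [← htK]; exact htmono' i K hi
  -- the tail `κ` and the Mertens slack `η`
  set κ := min κ₀ (ε * b / (8 * M)) with hκ
  have hκ0 : 0 < κ := lt_min hκ₀ (by positivity)
  have hκle : κ ≤ κ₀ := min_le_left _ _
  have hκε : κ ≤ ε * b / (8 * M) := min_le_right _ _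
  set η := ε / (8 * ((K : ℝ) * (M + ω) + M + 1)) with hη
  have hη0 : 0 < η := by positivity
  obtain ⟨u₀, hu₀3, hMert⟩ := exists_sum_inv_sub_one_le hη0
  refine ⟨κ, hκ0, hκle, ?_⟩
  have hE1 : ∀ᶠ x : ℕ in atTop, u₀ ≤ (x : ℝ) ^ a :=
    ((tendsto_rpow_atTop ha).comp tendsto_natCast_atTop_atTop).eventually_ge_atTop _
  filter_upwards [hE1, eventually_ge_atTop 2] with x hxu₀ hx2 Q hQ
  have hx1 : (1 : ℝ) < x := by exact_mod_cast (show 1 < x by omega)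
  have hx0 : (0 : ℝ) < x := by linarith
  have hLx : 0 < Real.log x := Real.log_pos hx1
  have hlogrpow : ∀ s : ℝ, Real.log ((x : ℝ) ^ s) = s * Real.log x := fun s => Real.log_rpow hx0 s
  -- `log q/log x` from bounds on `q`
  have htq_ge : ∀ {q : ℕ} {s : ℝ}, q.Prime → (x : ℝ) ^ s ≤ q → s ≤ Real.log q / Real.log x := by
    intro q s hq hle
    rw [le_div_iff₀ hLx, ← hlogrpow]
    exact Real.log_le_log (Real.rpow_pos_of_pos hx0 s) hle
  have htq_lt : ∀ {q : ℕ} {s : ℝ}, q.Prime → (q : ℝ) < (x : ℝ) ^ s → Real.log q / Real.log x < s := by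
    intro q s hq hlt
    have hq0 : (0 : ℝ) < q := by exact_mod_cast hq.pos
    rw [div_lt_iff₀ hLx, ← hlogrpow]
    exact Real.log_lt_log hq0 hlt
  -- the weight
  set f : ℕ → ℝ := fun q => g (Real.log q / Real.log x) / ((q : ℝ) - 1) with hf
  have hf_nonneg : ∀ {q : ℕ}, q.Prime → (x : ℝ) ^ a ≤ q → (q : ℝ) < (x : ℝ) ^ (b + κ) → 0 ≤ f q := by
    intro q hq h1 h2
    have hq2 : (2 : ℝ) ≤ q := by exact_mod_cast hq.two_le
    have hmem : Real.log q / Real.log x ∈ Set.Icc a (b + κ₀) :=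
      ⟨htq_ge hq h1, by have := htq_lt hq h2; linarith⟩
    exact div_nonneg (hg0 _ hmem) (by linarith)
  -- the blocks of primes
  set B : ℕ → Finset ℕ := fun i =>
    (Nat.primesBelow ⌈(x : ℝ) ^ t (i + 1)⌉₊).filter (fun p : ℕ => (x : ℝ) ^ t i ≤ (p : ℝ)) with hB
  have hBmem : ∀ i q, q ∈ B i → q.Prime ∧ (x : ℝ) ^ t i ≤ q ∧ (q : ℝ) < (x : ℝ) ^ t (i + 1) := by
    intro i q hq
    simp only [hB, Finset.mem_filter, Nat.mem_primesBelow, Nat.lt_ceil] at hq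
    exact ⟨hq.1.2, hq.2, hq.1.1⟩
  set Bt : Finset ℕ :=
    (Nat.primesBelow ⌈(x : ℝ) ^ (b + κ)⌉₊).filter (fun p : ℕ => (x : ℝ) ^ b ≤ (p : ℝ)) with hBt
  have hBtmem : ∀ q, q ∈ Bt → q.Prime ∧ (x : ℝ) ^ b ≤ q ∧ (q : ℝ) < (x : ℝ) ^ (b + κ) := by
    intro q hq
    simp only [hBt, Finset.mem_filter, Nat.mem_primesBelow, Nat.lt_ceil] at hq
    exact ⟨hq.1.2, hq.2, hq.1.1⟩
  have hxab : (x : ℝ) ^ a ≤ (x : ℝ) ^ b := Real.rpow_le_rpow_of_exponent_le hx1.le hab.le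
  -- split `Q` at `x^b`
  classical
  set Q₁ := Q.filter (fun q : ℕ => (q : ℝ) < (x : ℝ) ^ b) with hQ₁
  set Q₂ := Q.filter (fun q : ℕ => ¬ (q : ℝ) < (x : ℝ) ^ b) with hQ₂
  have hsplit : ∑ q ∈ Q, f q = ∑ q ∈ Q₁, f q + ∑ q ∈ Q₂, f q :=
    (Finset.sum_filter_add_sum_filter_not Q _ f).symm
  -- (i) the tail
  have htail : ∑ q ∈ Q₂, f q ≤ M * (η + Real.log ((b + κ) / b)) := by
    have hsub : Q₂ ⊆ Bt := by
      intro q hq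
      rw [hQ₂, Finset.mem_filter] at hq
      obtain ⟨hqQ, hqb⟩ := hq
      obtain ⟨hqp, -, hqlt⟩ := hQ q hqQ
      simp only [hBt, Finset.mem_filter, Nat.mem_primesBelow, Nat.lt_ceil]
      exact ⟨⟨hqlt, hqp⟩, not_lt.mp hqb⟩
    have hfle : ∀ q ∈ Bt, f q ≤ M * (1 / ((q : ℝ) - 1)) := by
      intro q hq
      obtain ⟨hqp, h1, h2⟩ := hBtmem q hq
      have hq2 : (2 : ℝ) ≤ q := by exact_mod_cast hqp.two_le
      have hmem : Real.log q / Real.log x ∈ Set.Icc a (b + κ₀) :=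
        ⟨(htq_ge hqp (hxab.trans h1)), by have := htq_lt hqp h2; linarith⟩
      simp only [hf]
      rw [mul_one_div]
      exact div_le_div_of_nonneg_right (hgM _ hmem) (by linarith)
    have hMt := hMert ((x : ℝ) ^ b) ((x : ℝ) ^ (b + κ)) (hxu₀.trans hxab)
      (Real.rpow_lt_rpow_of_exponent_lt hx1 (by linarith))
    rw [hlogrpow, hlogrpow, mul_div_mul_right _ _ hLx.ne'] at hMt
    calc ∑ q ∈ Q₂, f q ≤ ∑ q ∈ Bt, f q :=
          Finset.sum_le_sum_of_subset_of_nonneg hsub fun q hq _ => by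
            obtain ⟨hqp, h1, h2⟩ := hBtmem q hq
            exact hf_nonneg hqp (hxab.trans h1) h2
      _ ≤ ∑ q ∈ Bt, M * (1 / ((q : ℝ) - 1)) := Finset.sum_le_sum hfle
      _ = M * ∑ q ∈ Bt, 1 / ((q : ℝ) - 1) := by rw [Finset.mul_sum]
      _ ≤ M * (η + Real.log ((b + κ) / b)) := mul_le_mul_of_nonneg_left hMt hM0.le
  -- (ii) the cover of `Q₁` by the blocks
  have hcover : ∀ q ∈ Q₁, ∃ i ∈ Finset.range K, q ∈ B i := by
    intro q hq
    rw [hQ₁, Finset.mem_filter] at hq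
    obtain ⟨hqQ, hqb⟩ := hq
    obtain ⟨hqp, hqa, -⟩ := hQ q hqQ
    have hqb' : (q : ℝ) < (x : ℝ) ^ t K := by rwa [htK]
    have hex : ∃ i, (q : ℝ) < (x : ℝ) ^ t (i + 1) := ⟨K - 1, by rwa [Nat.sub_add_cancel hK1]⟩
    set i₀ := Nat.find hex with hi₀
    have hi₀spec : (q : ℝ) < (x : ℝ) ^ t (i₀ + 1) := Nat.find_spec hex
    have hi₀K : i₀ ≤ K - 1 := Nat.find_min' hex (by rwa [Nat.sub_add_cancel hK1])
    have hlow : (x : ℝ) ^ t i₀ ≤ q := by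
      rcases Nat.eq_zero_or_pos i₀ with h0 | hpos
      · rw [h0, ht0]; exact hqa
      · obtain ⟨j, hj⟩ : ∃ j, i₀ = j + 1 := ⟨i₀ - 1, by omega⟩
        have hmin := Nat.find_min hex (show j < i₀ by omega)
        rw [hj]
        exact not_lt.mp hmin
    refine ⟨i₀, Finset.mem_range.mpr (by omega), ?_⟩
    simp only [hB, Finset.mem_filter, Nat.mem_primesBelow, Nat.lt_ceil]
    exact ⟨⟨hi₀spec, hqp⟩, hlow⟩
  have hfnn : ∀ i ∈ Finset.range K, ∀ q ∈ B i, 0 ≤ f q := by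
    intro i hi q hq
    have hiK : i + 1 ≤ K := Finset.mem_range.mp hi
    obtain ⟨hqp, h1, h2⟩ := hBmem i q hq
    have ha' : (x : ℝ) ^ a ≤ q := (Real.rpow_le_rpow_of_exponent_le hx1.le (hta i)).trans h1
    have hb' : (q : ℝ) < (x : ℝ) ^ (b + κ) :=
      h2.trans_le (Real.rpow_le_rpow_of_exponent_le hx1.le (by linarith [htb (i + 1) hiK]))
    exact hf_nonneg hqp ha' hb'
  -- (iii) the block sums
  have hblock : ∀ i ∈ Finset.range K,
      ∑ q ∈ B i, f q ≤ (M + ω) * η + ∫ s in t i..t (i + 1), (g s + 2 * ω) / s := by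
    intro i hi
    have hiK : i + 1 ≤ K := Finset.mem_range.mp hi
    have hti0 : 0 < t i := lt_of_lt_of_le ha (hta i)
    have hsubI : Set.Icc (t i) (t (i + 1)) ⊆ Set.Icc a (b + κ₀) := fun s hs =>
      ⟨(hta i).trans hs.1, hs.2.trans (by linarith [htb (i + 1) hiK])⟩
    -- uniform continuity on the block
    have hnear : ∀ s ∈ Set.Icc (t i) (t (i + 1)), g (t i) ≤ g s + ω ∧ g s ≤ g (t i) + ω := by
      intro s hs
      have hdist : dist s (t i) < ρ := by
        rw [Real.dist_eq, abs_of_nonneg (by linarith [hs.1])]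
        linarith [hs.2, htstep i]
      have hmem_s : s ∈ Set.Icc a (b + κ₀) := hsubI hs
      have hmem_t : t i ∈ Set.Icc a (b + κ₀) := hsubI ⟨le_rfl, (htmono i).le⟩
      have h := hρ s hmem_s (t i) hmem_t hdist
      rw [Real.dist_eq] at h
      constructor <;> linarith [(abs_lt.mp h).1, (abs_lt.mp h).2]
    -- the weight on the block
    have hfle : ∀ q ∈ B i, f q ≤ (g (t i) + ω) * (1 / ((q : ℝ) - 1)) := by
      intro q hq
      obtain ⟨hqp, h1, h2⟩ := hBmem i q hq
      have hq2 : (2 : ℝ) ≤ q := by exact_mod_cast hqp.two_le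
      have hmem : Real.log q / Real.log x ∈ Set.Icc (t i) (t (i + 1)) :=
        ⟨htq_ge hqp h1, (htq_lt hqp h2).le⟩
      simp only [hf]
      rw [mul_one_div]
      exact div_le_div_of_nonneg_right (hnear _ hmem).2 (by linarith)
    have hgt0 : 0 ≤ g (t i) + ω := by
      have := hg0 (t i) (hsubI ⟨le_rfl, (htmono i).le⟩)
      linarith
    have hMt := hMert ((x : ℝ) ^ t i) ((x : ℝ) ^ t (i + 1))
      (hxu₀.trans (Real.rpow_le_rpow_of_exponent_le hx1.le (hta i)))
      (Real.rpow_lt_rpow_of_exponent_lt hx1 (htmono i))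
    rw [hlogrpow, hlogrpow, mul_div_mul_right _ _ hLx.ne'] at hMt
    have hint := mul_log_div_le_integral (c := g (t i)) (ω := ω) hti0 (htmono i).le
      (hg.mono hsubI) fun s hs => (hnear s hs).1
    have hgM' : g (t i) ≤ M := hgM _ (hsubI ⟨le_rfl, (htmono i).le⟩)
    calc ∑ q ∈ B i, f q ≤ ∑ q ∈ B i, (g (t i) + ω) * (1 / ((q : ℝ) - 1)) := Finset.sum_le_sum hfle
      _ = (g (t i) + ω) * ∑ q ∈ B i, 1 / ((q : ℝ) - 1) := by rw [Finset.mul_sum]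
      _ ≤ (g (t i) + ω) * (η + Real.log (t (i + 1) / t i)) := mul_le_mul_of_nonneg_left hMt hgt0
      _ = (g (t i) + ω) * η + (g (t i) + ω) * Real.log (t (i + 1) / t i) := by ring
      _ ≤ (M + ω) * η + ∫ s in t i..t (i + 1), (g s + 2 * ω) / s := by
          gcongr
  -- (iv) the integrals over the blocks add up
  have hint_all : ∀ k < K, IntervalIntegrable (fun s : ℝ => (g s + 2 * ω) / s) MeasureTheory.volume
      (t k) (t (k + 1)) := by
    intro k hk
    have hsubI : Set.Icc (t k) (t (k + 1)) ⊆ Set.Icc a (b + κ₀) := fun s hs =>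
      ⟨(hta k).trans hs.1, hs.2.trans (by linarith [htb (k + 1) hk])⟩
    exact (continuousOn_add_div (lt_of_lt_of_le ha (hta k)) (hg.mono hsubI)).intervalIntegrable_of_Icc
      (htmono k).le
  have hsumInt : ∑ i ∈ Finset.range K, ∫ s in t i..t (i + 1), (g s + 2 * ω) / s =
      ∫ s in a..b, (g s + 2 * ω) / s := by
    rw [intervalIntegral.sum_integral_adjacent_intervals hint_all, ht0, htK]
  have hIab : ∫ s in a..b, (g s + 2 * ω) / s = (∫ s in a..b, g s / s) + 2 * ω * Real.log (b / a) := by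
    have hga : ContinuousOn (fun s : ℝ => g s / s) (Set.Icc a b) :=
      (hg.mono (Set.Icc_subset_Icc le_rfl (by linarith))).div continuousOn_id fun s hs => by
        show s ≠ 0
        exact ne_of_gt (lt_of_lt_of_le ha hs.1)
    have hca : ContinuousOn (fun s : ℝ => 2 * ω / s) (Set.Icc a b) :=
      continuousOn_const.div continuousOn_id fun s hs => by
        show s ≠ 0
        exact ne_of_gt (lt_of_lt_of_le ha hs.1)
    have e : (fun s : ℝ => (g s + 2 * ω) / s) = fun s => g s / s + 2 * ω / s := by
      funext s; ring
    rw [e, intervalIntegral.integral_add (hga.intervalIntegrable_of_Icc hab.le)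
      (hca.intervalIntegrable_of_Icc hab.le)]
    congr 1
    simp_rw [div_eq_mul_inv (2 * ω)]
    rw [intervalIntegral.integral_const_mul, integral_inv_of_pos ha hb]
  -- (v) assemble
  have hmain : ∑ q ∈ Q₁, f q ≤ (K : ℝ) * ((M + ω) * η) +
      ((∫ s in a..b, g s / s) + 2 * ω * Real.log (b / a)) := by
    calc ∑ q ∈ Q₁, f q ≤ ∑ i ∈ Finset.range K, ∑ q ∈ B i, f q :=
          sum_le_sum_sum_of_cover _ B _ f hcover hfnn
      _ ≤ ∑ i ∈ Finset.range K, ((M + ω) * η + ∫ s in t i..t (i + 1), (g s + 2 * ω) / s) :=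
          Finset.sum_le_sum hblock
      _ = (K : ℝ) * ((M + ω) * η) + ∫ s in a..b, (g s + 2 * ω) / s := by
          rw [Finset.sum_add_distrib, Finset.sum_const, Finset.card_range, nsmul_eq_mul, hsumInt]
      _ = _ := by rw [hIab]
  -- the three small terms
  have hs1 : 2 * ω * Real.log (b / a) ≤ ε / 4 := by
    have : Real.log (b / a) ≤ Lg := by rw [hLg]; linarith
    calc 2 * ω * Real.log (b / a) ≤ 2 * ω * Lg := by gcongr
      _ = ε / 4 := by rw [hω]; field_simp; ring
  have hs2 : (K : ℝ) * ((M + ω) * η) + M * η ≤ ε / 8 := by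
    have e : (K : ℝ) * ((M + ω) * η) + M * η = ((K : ℝ) * (M + ω) + M) * η := by ring
    rw [e, hη, mul_div_assoc', div_le_iff₀ (by positivity)]
    nlinarith [hKpos, hM0, hω0, hε]
  have hs3 : M * Real.log ((b + κ) / b) ≤ ε / 8 := by
    have hlog : Real.log ((b + κ) / b) ≤ κ / b := by
      have hpos : 0 < (b + κ) / b := by positivity
      have := Real.log_le_sub_one_of_pos hpos
      rw [show (b + κ) / b - 1 = κ / b by field_simp; ring] at this
      exact this
    calc M * Real.log ((b + κ) / b) ≤ M * (κ / b) := mul_le_mul_of_nonneg_left hlog hM0.le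
      _ ≤ M * (ε * b / (8 * M) / b) := by gcongr
      _ = ε / 8 := by field_simp
  -- conclusion
  show ∑ q ∈ Q, f q ≤ (∫ s in a..b, g s / s) + ε
  rw [hsplit]
  have htail' : ∑ q ∈ Q₂, f q ≤ M * η + M * Real.log ((b + κ) / b) := by
    rw [← mul_add]; exact htail
  linarith [hmain, htail', hs1, hs2, hs3]

end Literature.NumberTheory.Sieve.Chen
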